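import Summits.QuantumFields.BalabanUV.Beta.GAN24.Lin4LegTower
import Summits.QuantumFields.BalabanUV.Beta.GAN24.TransversalZeroModeLoc

/-!
# `BalabanUV.Beta.GAN24.LegLetterZeroMode` — binder row G-an2-4 ∕ (CONV-C), W-slot, the (α-0) parity re-cut, located crux (Q-L-k₀):
# **THE KERNEL-LEG LETTERS ARE ZERO-MODE-FREE** — the class row «ff-charge-free» of RULING R-gan24p1-g35-1 (2)(a) is AUTOMATIC for `rdiv`-images
# (OWNER `b2b-balaban-gan24-p1`, gen 35; journal RULING R-gan24p1-g35-1 l.52806, lemma named there `zmode_rdiv_eq_zero`)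

NOT IN PRINT; OUR BOOKKEEPING ([folklore] telescoping of an absolutely convergent lattice sum; 0 `def`, 0 cited facts, 0 `def … : Prop`, 0 sorry).
HONEST FRAMING (cell contract, verbatim): «discharging `BetaPertH` makes Bałaban's UV stability UNCONDITIONAL — a real constructive-QFT result; it is NOT the
continuum limit and NOT the Clay problem.»  HONEST DEPENDENCY (verbatim): «continuum YM on T⁴ ⇐ BetaPertH ∧ nine spine estimates (0/9 proved); BetaPertH ⇐
(D1) ∧ (D4) ∧ CAP+tail; G-an2-4 gates asym, D1 and NE2/3/4.»

WHY.  RULING R-gan24p1-g35-1 locates (Q-L-k₀) as the dressed twin of ROW W3-F3b (`TransportIrrelevant`): the k₀-fold leg chain contracts on the class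
{jointly `Lc`-covariant, zero-mode-free, `LocStencil₂`} (the hypotheses `hcov`, `hZ` of leaf-17's `Push4Irr.push₄_locStencil₂_of_zff_env`).  For the LEG LETTERS
`rdiv (y κ u κ′ u′)` of a `LocStencil₂` table `y` (leaf-03 g60's `Lin4LegTower.rdiv`: the backward divergence of the right field leg, the former right site kept as a
position index) the zero-mode row costs NOTHING: the position sum telescopes.
WHAT (generic `d`, any period `N`, every direction ∕ fibre pair):
* §1 `tsum_sub_shift_eq_zero` — `Σ'_p (f (p − e) − f p) = 0` for a summable `f` on the lattice; `tsum_rdiv_eq_zero` — the position sum of `rdiv F x · a b`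
  vanishes whenever the right-leg slices `p ↦ F x p a (inl β)` are summable.
* §2 **`zmode_rdiv_eq_zero`** — `LocStencil₂ y C δ`, `0 < δ` ⟹ `zmode N (fun κ u κ′ u′ => rdiv (y κ u κ′ u′)) κ κ′ a b = 0` for ALL `κ κ′ a b` (not only the
  ff pair): the leg letters are in (Q-L-k₀)'s class row (a) with no hypothesis on `y`'s own charges.
Asserts NOTHING about Bałaban's tables; discharges NOTHING of (Q-L) ∕ (H1♮) ∕ (C) ∕ «T2Shape» ∕ «T2Drift» ∕ (hW, hWall); NEVER «G-an2-4 closed» as (CONV-C);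
NOT D1, NOT `BetaPertH`, NOT continuum, NOT Clay.  2026-08-23; no existing file touched.
-/

noncomputable section

open Finset
open scoped BigOperators
open Literature.MathematicalPhysics.QuantumFieldTheory
open Literature.MathematicalPhysics.QuantumFieldTheory.Balaban1983to89
open Literature.MathematicalPhysics.QuantumFieldTheory.Balaban1983to89.Beta
open B6BondElimination (unitVec)
open ExpKernelCalculus (MKer Site)
open OneStepResolventKernel (Fib)
open AffineAveraging (box toSite)
open BalabanCompositeJets (LocStencil₂)
open Summit.QuantumFields.BalabanUV.Beta.GAN24.BiStencilZeroMode (Tab zmode)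
open Summit.QuantumFields.BalabanUV.Beta.GAN24.Lin4LegTower (rdiv rdiv_apply)
open Summit.QuantumFields.BalabanUV.Beta.GAN24.TransversalZeroModeLoc (summable_z)

namespace Summit.QuantumFields.BalabanUV.Beta.GAN24.LegLetterZeroMode

variable {d : ℕ}

/-! ## §1 Telescoping on the lattice -/

/-- [folklore] A backward difference of a summable lattice function sums to zero: `Σ'_p (f (p − e) − f p) = 0`. -/
theorem tsum_sub_shift_eq_zero {f : Site (d + 1) → ℝ} (hf : Summable f) (e : Site (d + 1)) :
    ∑' p, (f (p - e) - f p) = 0 := by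
  have hshift : Summable fun p : Site (d + 1) => f (p - e) := (Equiv.subRight e).summable_iff.mpr hf
  rw [hshift.tsum_sub hf, sub_eq_zero]
  exact (Equiv.subRight e).tsum_eq f

/-- [folklore] **THE POSITION SUM OF A LEG LETTER VANISHES**: if every right-leg field slice `p ↦ F x p a (inl β)` is summable, then
`Σ'_p rdiv F x p a b = 0`. -/
theorem tsum_rdiv_eq_zero (F : MKer (d + 1) (Fib d)) (x : Site (d + 1)) (a b : Fib d)
    (hF : ∀ β : Fin (d + 1), Summable fun p : Site (d + 1) => F x p a (Sum.inl β)) :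
    ∑' p, rdiv F x p a b = 0 := by
  simp only [rdiv_apply]
  have hs : ∀ β ∈ (univ : Finset (Fin (d + 1))), Summable fun p : Site (d + 1) => F x (p - unitVec β) a (Sum.inl β) - F x p a (Sum.inl β) :=
    fun β _ => ((Equiv.subRight (unitVec β)).summable_iff.mpr (hF β)).sub (hF β)
  rw [Summable.tsum_finsetSum hs]
  exact Finset.sum_eq_zero fun β _ => tsum_sub_shift_eq_zero (hF β) (unitVec β)

/-! ## §2 The leg letters of a `LocStencil₂` table are zero-mode-free -/

/-- NOT IN PRINT; OUR BOOKKEEPING.  **THE KERNEL-LEG LETTERS ARE ZERO-MODE-FREE**: for a `LocStencil₂` table `y` (rate `δ > 0`) and ANY period `N`,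
`zmode N (fun κ u κ′ u′ => rdiv (y κ u κ′ u′)) κ κ′ a b = 0` for every direction pair and every fibre pair — the class row «charge-free» of
RULING R-gan24p1-g35-1 (2)(a) for the leg letters, with NO hypothesis on the charges of `y` itself. -/
theorem zmode_rdiv_eq_zero {y : Tab d} {C δ : ℝ} (hy : LocStencil₂ y C δ) (hδ : 0 < δ) (N : ℕ) (κ κ' : Fin (d + 1)) (a b : Fib d) :
    zmode N (fun κ u κ' u' => rdiv (y κ u κ' u')) κ κ' a b = 0 := by
  unfold zmode
  refine Finset.sum_eq_zero fun r _ => ?_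
  have hinner : ∀ (u' x : Site (d + 1)), (∑' p, rdiv (y κ (toSite r) κ' u') x p a b) = 0 := fun u' x =>
    tsum_rdiv_eq_zero (y κ (toSite r) κ' u') x a b (fun β => summable_z hy hδ κ (toSite r) κ' u' x a (Sum.inl β))
  simp only [hinner, tsum_zero]

end Summit.QuantumFields.BalabanUV.Beta.GAN24.LegLetterZeroMode

end
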